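import Summits.BirchSwinnertonDyer.BirchSwinnertonDyer.Theorems.GenusKolyvaginAtTwoShaCardDvdPowAtTwoRTShaFiniteAtTwoCTFrame
import Summits.BirchSwinnertonDyer.BirchSwinnertonDyer.Theorems.GenusKolyvaginAtTwoVisiblePairAtTwoCasselsTateCTFree
import Literature.NumberTheory.EllipticCurves.ShaRestrictionIndex
import Literature.NumberTheory.EllipticCurves.KolyvaginShaStructureAnyLevel
import Literature.NumberTheory.EllipticCurves.WeilPairingProofs
import HarnessLib

/-!
# Route `GenusKolyvaginAtTwo`, crux U_T `ShaCardDvdPowAtTwoRT` (stmt-BirchSwinnertonDyer-23658), LINE 19 `rational_pair_descent`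
# (LEAD gk2-p1 g19), stub PAIRCOUNT `stub_shaRatCardDvdOfMinimalTwin` — ITS FRAME OVER `ℚ`:
# `Ш(E/ℚ)[2^∞]` finite, killed by `2^(M₀+3)`, of order `2^(2t)`, carrying a non-degenerate alternating Cassels–Tate pairing;
# PAIRCOUNT ⟸ «every isotropic subgroup of `Ш(E/ℚ)[2^∞]` has order ≤ 2^M₀»

Seat `bsd-line-gk2-p5` g29 (WIDTH-5 attach, cell `bsd-f1-sign2`), `--supports stmt-BirchSwinnertonDyer-23658` (helper; closes nothing).
THEOREMS ONLY (no definition, no named fact, no `sorry`).  BSD is NOT proved by any of this; neither is U_T, nor PAIRCOUNT.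

WHY.  LINE 19 runs McCallum's count over `ℚ` for the rank-zero member `E` (stub PAIRCOUNT: `#Ш(E/ℚ)[2^∞] ∣ 4^M₀`), with «`Zm` = lift of a
Lagrangian of `Ш(E/ℚ)[2^∞]`».  To speak of a Lagrangian one needs `Ш(E/ℚ)[2^∞]` FINITE with a NON-DEGENERATE alternating pairing on ALL of
it, i.e. an explicit `2^k` killing `Ш(E/ℚ)[2^∞]` and the level-`2^k` Cassels–Tate pairing transported to the `2`-primary component — the `ℚ`-side
twin of `…RTShaFiniteAtTwo` / `…RTShaFiniteAtTwoCTFrame` (this seat, p746739 / p747560).  Mechanism: restriction `Ш(E/ℚ) → Ш(E/K)` has kernel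
inflated from `H¹(K/ℚ, E(K))`, killed by `[K : ℚ] = 2` (§0), and `2^(M₀+2)` kills `Ш(E/K)[2^∞]`.

* §0 `finrank_nsmul_eq_zero_of_mem_localRestrictionKer` — for ANY elliptic `E/F` and finite Galois `L/F`: `[L:F] • c = 0` for every
  `c ∈ ker(H¹(F, E) → H¹(L, E))` (`resKer_le_range_inflClass` + `index_nsmul_inflClass` + `index_galSubgroupClosure_eq_finrank_of_isGalois`);
  `finrank_nsmul_eq_zero_of_shaRestriction_eq_zero` — the same for `ker(Ш(E/F) → Ш(E_L/L))`.
* §1 on U_T's frame: `two_pow_smul_eq_zero_of_mem_sha_rat_onHabitat` (`2^(M₀+3) • a = 0` for `a ∈ Ш(E/ℚ)` of `2`-power order),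
  `two_pow_smul_primaryComponent_sha_rat_eq_zero_onHabitat` (`hk` form), `primaryComponent_sha_rat_two_eq_torsionBy_onHabitat`,
  **`finite_primaryComponent_sha_rat_two_onHabitat`** and **`finite_primaryComponent_sha_twin_two_onHabitat`** (also the twin `E^(d_K)`, every
  `ℚ`-model; `finite_primaryComponent_sha_of_finite_baseChange_quadratic`), `exists_natCard_primaryComponent_sha_rat_two_eq_pow_two_mul_onHabitat`
  (`#Ш(E/ℚ)[2^∞] = 2^(2t)`).
* §2 `exists_primaryComponent_pairing_rat_of_isLevelPairing_onHabitat` (every level pairing on `Ш(E/ℚ)[2^k]`, `k ≥ M₀+3`, IS a non-degenerate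
  alternating pairing on `Ш(E/ℚ)[2^∞]`), `exists_nondegenerate_alternating_pairing_primaryComponent_sha_rat_two_onHabitat` (existence with Milne's
  `ctLevelPairing` of the canonical invariant maps over `ℚ`, a level pairing by gk2-p2's `VisiblePairAtTwo.isLevelPairing_ctLevelPairing_canonical`).
* §3 **`natCard_primaryComponent_sha_rat_two_dvd_of_forall_isotropic_card_le_onHabitat`** — PAIRCOUNT's conclusion `#Ш(E/ℚ)[2^∞] ∣ 2^(2M₀)` from
  «every `B₂`-isotropic subgroup of `Ш(E/ℚ)[2^∞]` has order `≤ 2^M₀`», for ANY alternating non-degenerate `B₂` (Wall / Tignol–Amitsur).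

References: [McCallumLMS1991] §5, proof of Thm. 5.4 (p. 288); [Kramer1981] proof of Thm. 2; [SerreGaloisCohomology1997] I.§2.4 Cor. to Prop. 9;
[MilneADT2006] Ch. I §6, Prop. 6.9, Thm. 6.13 (a); [Cassels1962ArithmeticIV]; [Wall1963QuadraticFormsFiniteGroups] Lemma 7; [Kolyvagin1990] Thm. A.
-/

set_option autoImplicit false
-- the Theorems namespace of this sub repeats the summit name by design (D-0017 nested layout)
set_option linter.dupNamespace false

noncomputable section

open scoped Classical
open scoped AddSubgroup

namespace Summit.BirchSwinnertonDyer.BirchSwinnertonDyer.Theorems.GenusExact.PlusDescent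

open WeierstrassCurve NumberField IsDedekindDomain Field Literature.NumberTheory.EllipticCurves
  Literature.NumberTheory.GaloisRepresentations Literature.NumberTheory.EllipticCurves.ModularForms AddSubgroup
open Summit.BirchSwinnertonDyer.BirchSwinnertonDyer.Theses.GenusKolyvaginAtTwo (KolyvaginRelationAtTwo)
open Summit.BirchSwinnertonDyer.Rank1Residual
open Literature.GroupTheory.FiniteAbelian (IsLevelPairing)

universe u

/-! ## §0 `[L : F]` kills the kernel of restriction along a finite Galois extension -/

section Galois

open IntermediateField

variable {F : Type u} [Field F] [NumberField F] (V : WeierstrassCurve F) (L : Type u) [Field L] [NumberField L] [Algebra F L]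

/-- **`[L : F] • ker(H¹(F, E) → H¹(L, E)) = 0` for a finite Galois extension `L/F`**: the kernel is inflated from crossed homomorphisms
vanishing on `Γ_{L̃} = Γ_L` (`resKer_le_range_inflClass`), and `[Γ_F : Γ_L] = [L : F]` kills every inflated class (`index_nsmul_inflClass`,
`res ∘ cor`). [cite: SerreGaloisCohomology1997, I.§2.4 Cor. to Prop. 9 and I.§5.8] [cite: Kramer1981, proof of Thm. 2] -/
theorem finrank_nsmul_eq_zero_of_mem_localRestrictionKer [IsGalois F L] {c : V.galH1} (hc : c ∈ V.localRestrictionKer L) :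
    Module.finrank F L • c = 0 := by
  haveI : FiniteDimensional F L := Module.Finite.of_restrictScalars_finite ℚ F L
  set N : Subgroup (Field.absoluteGaloisGroup F) := galSubgroupClosure (K := F) L with hNdef
  have hidx : N.index = Module.finrank F L := by rw [hNdef, index_galSubgroupClosure_eq_finrank_of_isGalois L]
  haveI : N.FiniteIndex := ⟨by rw [hidx]; exact Module.finrank_pos.ne'⟩
  have hle : V.localRestrictionKer L ≤ (inflClass (geomPoints V) N (isOpen_galSubgroupClosure L)).range :=
    resKer_le_range_inflClass (resGal (K := F) L) (pointsMap V L) (pointsMap_smul V L)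
      (pointsMapOfEmb_bijective L V _) N (isOpen_galSubgroupClosure L) (galSubgroupClosure_le_range_resGal L)
  obtain ⟨f, hf⟩ := hle hc
  rw [← hf, ← hidx]
  exact index_nsmul_inflClass N (isOpen_galSubgroupClosure L) f

/-- **`[L : F] • ker(Ш(E/F) → Ш(E_L/L)) = 0`** for a finite Galois extension `L/F`. [cite: Kramer1981, proof of Thm. 2]
[cite: SerreGaloisCohomology1997, I.§2.4 Cor. to Prop. 9] -/
theorem finrank_nsmul_eq_zero_of_shaRestriction_eq_zero [IsGalois F L] {a : V.sha} (ha : shaRestriction V L a = 0) :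
    Module.finrank F L • a = 0 := by
  have hker : ((a : V.galH1)) ∈ V.localRestrictionKer L :=
    (mem_ker_resBaseChange_iff V L _).mp (by rw [← coe_shaRestriction_apply, ha]; rfl)
  exact Subtype.ext (by
    rw [AddSubgroupClass.coe_nsmul, ZeroMemClass.coe_zero]
    exact finrank_nsmul_eq_zero_of_mem_localRestrictionKer V L hker)

end Galois

/-! ## §1 `Ш(E/ℚ)[2^∞]` on U_T's frame: killed by `2^(M₀+3)`, finite, of order `2^(2t)` -/

/-- **`2^(M₀+3)` kills every class of `Ш(E/ℚ)` of `2`-power order, on U_T's frame** (restriction to `K` lands in `Ш(E/K)[2^∞]`, killed by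
`2^(M₀+2)` — `two_pow_smul_eq_zero_of_mem_sha_onHabitat`; the kernel of restriction is killed by `[K : ℚ] = 2`, §0).
[cite: Kolyvagin1990, Thm. A] [cite: Kramer1981, proof of Thm. 2] [cite: McCallumLMS1991, §5 (proof of Thm. 5.4, p. 288)] -/
theorem two_pow_smul_eq_zero_of_mem_sha_rat_onHabitat (hQ2 : KolyvaginRelationAtTwo)
    (W : WeierstrassCurve ℚ) [W.IsElliptic] [W.IsGloballyMinimal] [NeZero (W.conductorNorm ℤ)] (hcm : ¬ W.HasCM)
    (hT : Odd W.tamagawaProduct) (v : HeightOneSpectrum (𝓞 ℚ)) (h2v : ((2 : ℕ) : 𝓞 ℚ) ∉ v.asIdeal)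
    (hNv : ((W.conductorNorm ℤ : ℕ) : 𝓞 ℚ) ∈ v.asIdeal) (hmult : W.HasMultiplicativeReductionAt v) (hneg : W.Δ < 0)
    (K : Type) [Field K] [NumberField K] (hIQ : IsImaginaryQuadratic K) (hodd : Odd (NumberField.discr K))
    (h3 : NumberField.discr K ≠ -3) (hHe : SatisfiesHeegnerHypothesis (W.conductorNorm ℤ) K)
    (hsq1 : ¬ IsSquare ((NumberField.discr K : ℚ) * -|W.Δ|)) (hsq2 : ¬ IsSquare ((NumberField.discr K : ℚ) * (-(2 * |W.Δ|))))
    (hρ : ∀ n : ℕ, 0 < n → W.HasSurjectiveModNGaloisRep ((2 : ℤ) ^ n))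
    (Dt : ModularParametrizationData W (W.conductorNorm ℤ)) (β : ℤ) (ι : K →+* ℂ) (d₁ : KolyvaginHeegnerData Dt β ι 1) (M₀ : ℕ)
    (hndiv : ¬ ∃ Q : (W.baseChange (ringClassField K ι 1)).toAffine.Point, ((2 ^ (M₀ + 1) : ℕ) : ℤ) • Q = d₁.derivedPoint)
    {a : W.sha} {j : ℕ} (hja : 2 ^ j • a = 0) : 2 ^ (M₀ + 3) • a = 0 := by
  haveI : Algebra.IsQuadraticExtension ℚ K := ⟨hIQ.1⟩
  -- restriction to `K`: a class of `Ш(E/K)` of `2`-power order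
  set b : (W.baseChange K).sha := shaRestriction W K a with hb
  have hjb : ((2 ^ j : ℕ) : ℤ) • ((b : (W.baseChange K).galH1)) = 0 := by
    rw [natCast_zsmul, ← AddSubgroupClass.coe_nsmul, hb, ← map_nsmul, hja, map_zero, ZeroMemClass.coe_zero]
  have hkill := two_pow_smul_eq_zero_of_mem_sha_onHabitat hQ2 W hcm hT v h2v hNv hmult hneg K hIQ hodd h3 hHe hsq1 hsq2 hρ Dt β ι d₁ M₀
    hndiv b.2 hjb
  -- so `2^(M₀+2) • a` restricts to `0`, hence is killed by `[K : ℚ] = 2`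
  have hres : shaRestriction W K (2 ^ (M₀ + 2) • a) = 0 := by
    rw [map_nsmul, ← hb]
    exact Subtype.ext (by rw [AddSubgroupClass.coe_nsmul, ZeroMemClass.coe_zero, ← natCast_zsmul]; exact hkill)
  have h2 := finrank_nsmul_eq_zero_of_shaRestriction_eq_zero W K hres
  rw [hIQ.1, ← mul_nsmul, ← pow_succ] at h2
  exact h2

/-- **The `hk` form over `ℚ`: `2^(M₀+3) • x = 0` for every `x ∈ Ш(E/ℚ)[2^∞]`**, on U_T's frame. [cite: Kolyvagin1990, Thm. A]
[cite: McCallumLMS1991, §5 (proof of Thm. 5.4, p. 288)] -/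
theorem two_pow_smul_primaryComponent_sha_rat_eq_zero_onHabitat (hQ2 : KolyvaginRelationAtTwo)
    (W : WeierstrassCurve ℚ) [W.IsElliptic] [W.IsGloballyMinimal] [NeZero (W.conductorNorm ℤ)] (hcm : ¬ W.HasCM)
    (hT : Odd W.tamagawaProduct) (v : HeightOneSpectrum (𝓞 ℚ)) (h2v : ((2 : ℕ) : 𝓞 ℚ) ∉ v.asIdeal)
    (hNv : ((W.conductorNorm ℤ : ℕ) : 𝓞 ℚ) ∈ v.asIdeal) (hmult : W.HasMultiplicativeReductionAt v) (hneg : W.Δ < 0)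
    (K : Type) [Field K] [NumberField K] (hIQ : IsImaginaryQuadratic K) (hodd : Odd (NumberField.discr K))
    (h3 : NumberField.discr K ≠ -3) (hHe : SatisfiesHeegnerHypothesis (W.conductorNorm ℤ) K)
    (hsq1 : ¬ IsSquare ((NumberField.discr K : ℚ) * -|W.Δ|)) (hsq2 : ¬ IsSquare ((NumberField.discr K : ℚ) * (-(2 * |W.Δ|))))
    (hρ : ∀ n : ℕ, 0 < n → W.HasSurjectiveModNGaloisRep ((2 : ℤ) ^ n))
    (Dt : ModularParametrizationData W (W.conductorNorm ℤ)) (β : ℤ) (ι : K →+* ℂ) (d₁ : KolyvaginHeegnerData Dt β ι 1) (M₀ : ℕ)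
    (hndiv : ¬ ∃ Q : (W.baseChange (ringClassField K ι 1)).toAffine.Point, ((2 ^ (M₀ + 1) : ℕ) : ℤ) • Q = d₁.derivedPoint) :
    ∀ x ∈ AddCommGroup.primaryComponent W.sha 2, 2 ^ (M₀ + 3) • x = 0 := by
  intro x hx
  obtain ⟨j, hj⟩ := (AddCommGroup.mem_primaryComponent).1 hx
  exact two_pow_smul_eq_zero_of_mem_sha_rat_onHabitat hQ2 W hcm hT v h2v hNv hmult hneg K hIQ hodd h3 hHe hsq1 hsq2 hρ Dt β ι d₁ M₀ hndiv hj

/-- **`Ш(E/ℚ)[2^∞] = Ш(E/ℚ)[2^(M₀+3)]`** on U_T's frame. [cite: Kolyvagin1990, Thm. A] [cite: McCallumLMS1991, §5 (proof of Thm. 5.4, p. 288)] -/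
theorem primaryComponent_sha_rat_two_eq_torsionBy_onHabitat (hQ2 : KolyvaginRelationAtTwo)
    (W : WeierstrassCurve ℚ) [W.IsElliptic] [W.IsGloballyMinimal] [NeZero (W.conductorNorm ℤ)] (hcm : ¬ W.HasCM)
    (hT : Odd W.tamagawaProduct) (v : HeightOneSpectrum (𝓞 ℚ)) (h2v : ((2 : ℕ) : 𝓞 ℚ) ∉ v.asIdeal)
    (hNv : ((W.conductorNorm ℤ : ℕ) : 𝓞 ℚ) ∈ v.asIdeal) (hmult : W.HasMultiplicativeReductionAt v) (hneg : W.Δ < 0)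
    (K : Type) [Field K] [NumberField K] (hIQ : IsImaginaryQuadratic K) (hodd : Odd (NumberField.discr K))
    (h3 : NumberField.discr K ≠ -3) (hHe : SatisfiesHeegnerHypothesis (W.conductorNorm ℤ) K)
    (hsq1 : ¬ IsSquare ((NumberField.discr K : ℚ) * -|W.Δ|)) (hsq2 : ¬ IsSquare ((NumberField.discr K : ℚ) * (-(2 * |W.Δ|))))
    (hρ : ∀ n : ℕ, 0 < n → W.HasSurjectiveModNGaloisRep ((2 : ℤ) ^ n))
    (Dt : ModularParametrizationData W (W.conductorNorm ℤ)) (β : ℤ) (ι : K →+* ℂ) (d₁ : KolyvaginHeegnerData Dt β ι 1) (M₀ : ℕ)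
    (hndiv : ¬ ∃ Q : (W.baseChange (ringClassField K ι 1)).toAffine.Point, ((2 ^ (M₀ + 1) : ℕ) : ℤ) • Q = d₁.derivedPoint) :
    AddCommGroup.primaryComponent W.sha 2 = (W.sha)[(2 ^ (M₀ + 3) : ℕ)] :=
  primaryComponent_eq_torsionBy
    (two_pow_smul_primaryComponent_sha_rat_eq_zero_onHabitat hQ2 W hcm hT v h2v hNv hmult hneg K hIQ hodd h3 hHe hsq1 hsq2 hρ Dt β ι d₁ M₀
      hndiv)

/-- **`Ш(E/ℚ)[2^∞]` is FINITE on U_T's frame** (from the `K`-side finiteness `finite_primaryComponent_sha_two_onHabitat` by the tree's corank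
bookkeeping `finite_primaryComponent_sha_of_finite_baseChange_quadratic`; equivalently from `Ш(E/ℚ)[2^∞] = Ш(E/ℚ)[2^(M₀+3)]` and AEC X.4.2 (b)).
[cite: Kolyvagin1990, Thm. A] [cite: Dokchitser2013ParityNotes, §4] [cite: SilvermanAEC2009, Thm. X.4.2 (b)] -/
theorem finite_primaryComponent_sha_rat_two_onHabitat (hQ2 : KolyvaginRelationAtTwo)
    (W : WeierstrassCurve ℚ) [W.IsElliptic] [W.IsGloballyMinimal] [NeZero (W.conductorNorm ℤ)] (hcm : ¬ W.HasCM)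
    (hT : Odd W.tamagawaProduct) (v : HeightOneSpectrum (𝓞 ℚ)) (h2v : ((2 : ℕ) : 𝓞 ℚ) ∉ v.asIdeal)
    (hNv : ((W.conductorNorm ℤ : ℕ) : 𝓞 ℚ) ∈ v.asIdeal) (hmult : W.HasMultiplicativeReductionAt v) (hneg : W.Δ < 0)
    (K : Type) [Field K] [NumberField K] (hIQ : IsImaginaryQuadratic K) (hodd : Odd (NumberField.discr K))
    (h3 : NumberField.discr K ≠ -3) (hHe : SatisfiesHeegnerHypothesis (W.conductorNorm ℤ) K)
    (hsq1 : ¬ IsSquare ((NumberField.discr K : ℚ) * -|W.Δ|)) (hsq2 : ¬ IsSquare ((NumberField.discr K : ℚ) * (-(2 * |W.Δ|))))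
    (hρ : ∀ n : ℕ, 0 < n → W.HasSurjectiveModNGaloisRep ((2 : ℤ) ^ n))
    (Dt : ModularParametrizationData W (W.conductorNorm ℤ)) (β : ℤ) (ι : K →+* ℂ) (d₁ : KolyvaginHeegnerData Dt β ι 1) (M₀ : ℕ)
    (hndiv : ¬ ∃ Q : (W.baseChange (ringClassField K ι 1)).toAffine.Point, ((2 ^ (M₀ + 1) : ℕ) : ℤ) • Q = d₁.derivedPoint) :
    Finite (AddCommGroup.primaryComponent W.sha 2) := by
  haveI : Fact (Nat.Prime 2) := ⟨Nat.prime_two⟩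
  haveI := finite_primaryComponent_sha_two_onHabitat hQ2 W hcm hT v h2v hNv hmult hneg K hIQ hodd h3 hHe hsq1 hsq2 hρ Dt β ι d₁ M₀ hndiv
  exact (finite_primaryComponent_sha_of_finite_baseChange_quadratic W K hIQ.1 2).1

/-- **`Ш(Wd/ℚ)[2^∞]` is FINITE for every `ℚ`-model `Wd` of the twist `E^(d_K)`, on U_T's frame** (same corank bookkeeping; the twin is the
rank-one member of LINE 19's pair). [cite: Kolyvagin1990, Thm. A] [cite: Dokchitser2013ParityNotes, §4] -/
theorem finite_primaryComponent_sha_twin_two_onHabitat (hQ2 : KolyvaginRelationAtTwo)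
    (W : WeierstrassCurve ℚ) [W.IsElliptic] [W.IsGloballyMinimal] [NeZero (W.conductorNorm ℤ)] (hcm : ¬ W.HasCM)
    (hT : Odd W.tamagawaProduct) (v : HeightOneSpectrum (𝓞 ℚ)) (h2v : ((2 : ℕ) : 𝓞 ℚ) ∉ v.asIdeal)
    (hNv : ((W.conductorNorm ℤ : ℕ) : 𝓞 ℚ) ∈ v.asIdeal) (hmult : W.HasMultiplicativeReductionAt v) (hneg : W.Δ < 0)
    (K : Type) [Field K] [NumberField K] (hIQ : IsImaginaryQuadratic K) (hodd : Odd (NumberField.discr K))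
    (h3 : NumberField.discr K ≠ -3) (hHe : SatisfiesHeegnerHypothesis (W.conductorNorm ℤ) K)
    (hsq1 : ¬ IsSquare ((NumberField.discr K : ℚ) * -|W.Δ|)) (hsq2 : ¬ IsSquare ((NumberField.discr K : ℚ) * (-(2 * |W.Δ|))))
    (hρ : ∀ n : ℕ, 0 < n → W.HasSurjectiveModNGaloisRep ((2 : ℤ) ^ n))
    (Dt : ModularParametrizationData W (W.conductorNorm ℤ)) (β : ℤ) (ι : K →+* ℂ) (d₁ : KolyvaginHeegnerData Dt β ι 1) (M₀ : ℕ)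
    (hndiv : ¬ ∃ Q : (W.baseChange (ringClassField K ι 1)).toAffine.Point, ((2 ^ (M₀ + 1) : ℕ) : ℤ) • Q = d₁.derivedPoint)
    (Wd : WeierstrassCurve ℚ) [Wd.IsElliptic] (hWd : ∃ C : WeierstrassCurve.VariableChange ℚ, C • W.quadraticTwist (NumberField.discr K : ℚ) = Wd) :
    Finite (AddCommGroup.primaryComponent Wd.sha 2) := by
  haveI : Fact (Nat.Prime 2) := ⟨Nat.prime_two⟩
  haveI := finite_primaryComponent_sha_two_onHabitat hQ2 W hcm hT v h2v hNv hmult hneg K hIQ hodd h3 hHe hsq1 hsq2 hρ Dt β ι d₁ M₀ hndiv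
  exact (finite_primaryComponent_sha_of_finite_baseChange_quadratic W K hIQ.1 2).2 Wd hWd

/-- **`#Ш(E/ℚ)[2^∞] = 2^(2t)` on U_T's frame** (finite `2`-group; Cassels–Tate squareness over `ℚ`, `CasselsTateNumberField.isSquare_natCard_primaryComponent_sha`).
[cite: SilvermanAEC2009, Thm. X.4.14] [cite: Kolyvagin1990, Thm. A] -/
theorem exists_natCard_primaryComponent_sha_rat_two_eq_pow_two_mul_onHabitat (hQ2 : KolyvaginRelationAtTwo)
    (W : WeierstrassCurve ℚ) [W.IsElliptic] [W.IsGloballyMinimal] [NeZero (W.conductorNorm ℤ)] (hcm : ¬ W.HasCM)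
    (hT : Odd W.tamagawaProduct) (v : HeightOneSpectrum (𝓞 ℚ)) (h2v : ((2 : ℕ) : 𝓞 ℚ) ∉ v.asIdeal)
    (hNv : ((W.conductorNorm ℤ : ℕ) : 𝓞 ℚ) ∈ v.asIdeal) (hmult : W.HasMultiplicativeReductionAt v) (hneg : W.Δ < 0)
    (K : Type) [Field K] [NumberField K] (hIQ : IsImaginaryQuadratic K) (hodd : Odd (NumberField.discr K))
    (h3 : NumberField.discr K ≠ -3) (hHe : SatisfiesHeegnerHypothesis (W.conductorNorm ℤ) K)
    (hsq1 : ¬ IsSquare ((NumberField.discr K : ℚ) * -|W.Δ|)) (hsq2 : ¬ IsSquare ((NumberField.discr K : ℚ) * (-(2 * |W.Δ|))))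
    (hρ : ∀ n : ℕ, 0 < n → W.HasSurjectiveModNGaloisRep ((2 : ℤ) ^ n))
    (Dt : ModularParametrizationData W (W.conductorNorm ℤ)) (β : ℤ) (ι : K →+* ℂ) (d₁ : KolyvaginHeegnerData Dt β ι 1) (M₀ : ℕ)
    (hndiv : ¬ ∃ Q : (W.baseChange (ringClassField K ι 1)).toAffine.Point, ((2 ^ (M₀ + 1) : ℕ) : ℤ) • Q = d₁.derivedPoint) :
    ∃ t : ℕ, Nat.card (AddCommGroup.primaryComponent W.sha 2) = 2 ^ (2 * t) := by
  haveI : Fact (Nat.Prime 2) := ⟨Nat.prime_two⟩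
  haveI := finite_primaryComponent_sha_rat_two_onHabitat hQ2 W hcm hT v h2v hNv hmult hneg K hIQ hodd h3 hHe hsq1 hsq2 hρ Dt β ι d₁ M₀ hndiv
  obtain ⟨k, hk⟩ := exists_natCard_addPrimaryComponent_eq_pow (A := W.sha) 2
  obtain ⟨r, hr⟩ := CasselsTateNumberField.isSquare_natCard_primaryComponent_sha W 2
  have hr2 : r * r = 2 ^ k := by rw [← hr, hk]
  have hrdvd : r ∣ 2 ^ k := ⟨r, hr2.symm⟩
  obtain ⟨t, -, rfl⟩ := (Nat.dvd_prime_pow Nat.prime_two).mp hrdvd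
  exact ⟨t, by rw [hr, ← pow_add, two_mul]⟩

/-! ## §2 The Cassels–Tate pairing on all of `Ш(E/ℚ)[2^∞]` -/

/-- **Every level pairing on `Ш(E/ℚ)[2^k]`, `k ≥ M₀ + 3`, IS a non-degenerate alternating pairing on all of `Ш(E/ℚ)[2^∞]`, on U_T's frame.**
[cite: McCallumLMS1991, §5, proof of Thm. 5.4 (p. 288)] [cite: MilneADT2006, Ch. I §6, Thm. 6.13 (a)] -/
theorem exists_primaryComponent_pairing_rat_of_isLevelPairing_onHabitat (hQ2 : KolyvaginRelationAtTwo)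
    (W : WeierstrassCurve ℚ) [W.IsElliptic] [W.IsGloballyMinimal] [NeZero (W.conductorNorm ℤ)] (hcm : ¬ W.HasCM)
    (hT : Odd W.tamagawaProduct) (v : HeightOneSpectrum (𝓞 ℚ)) (h2v : ((2 : ℕ) : 𝓞 ℚ) ∉ v.asIdeal)
    (hNv : ((W.conductorNorm ℤ : ℕ) : 𝓞 ℚ) ∈ v.asIdeal) (hmult : W.HasMultiplicativeReductionAt v) (hneg : W.Δ < 0)
    (K : Type) [Field K] [NumberField K] (hIQ : IsImaginaryQuadratic K) (hodd : Odd (NumberField.discr K))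
    (h3 : NumberField.discr K ≠ -3) (hHe : SatisfiesHeegnerHypothesis (W.conductorNorm ℤ) K)
    (hsq1 : ¬ IsSquare ((NumberField.discr K : ℚ) * -|W.Δ|)) (hsq2 : ¬ IsSquare ((NumberField.discr K : ℚ) * (-(2 * |W.Δ|))))
    (hρ : ∀ n : ℕ, 0 < n → W.HasSurjectiveModNGaloisRep ((2 : ℤ) ^ n))
    (Dt : ModularParametrizationData W (W.conductorNorm ℤ)) (β : ℤ) (ι : K →+* ℂ) (d₁ : KolyvaginHeegnerData Dt β ι 1) (M₀ : ℕ)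
    (hndiv : ¬ ∃ Q : (W.baseChange (ringClassField K ι 1)).toAffine.Point, ((2 ^ (M₀ + 1) : ℕ) : ℤ) • Q = d₁.derivedPoint)
    {k : ℕ} (hk : M₀ + 3 ≤ k) {T : Type*} [AddCommGroup T]
    (B : (W.sha)[(2 ^ k : ℕ)] →+ (W.sha)[(2 ^ k : ℕ)] →+ T) (hB : IsLevelPairing (2 ^ k) B) :
    ∃ (hle : AddCommGroup.primaryComponent W.sha 2 ≤ (W.sha)[(2 ^ k : ℕ)])
      (B₂ : AddCommGroup.primaryComponent W.sha 2 →+ AddCommGroup.primaryComponent W.sha 2 →+ T),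
      (∀ a b, B₂ a b = B ⟨a, hle a.2⟩ ⟨b, hle b.2⟩) ∧
      (∀ a, B₂ a a = 0) ∧ (∀ a b, B₂ b a = -(B₂ a b)) ∧
      (∀ a, (∀ b, B₂ a b = 0) → a = 0) ∧ (∀ b, (∀ a, B₂ a b = 0) → b = 0) := by
  have hk0 := two_pow_smul_primaryComponent_sha_rat_eq_zero_onHabitat hQ2 W hcm hT v h2v hNv hmult hneg K hIQ hodd h3 hHe hsq1 hsq2 hρ Dt β ι
    d₁ M₀ hndiv
  have hkk : ∀ x ∈ AddCommGroup.primaryComponent W.sha 2, 2 ^ k • x = 0 := pow_nsmul_primaryComponent_eq_zero_of_le hk0 hk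
  obtain ⟨B₂, hval, halt, hanti, hl, hr⟩ := exists_primaryComponent_pairing_of_isLevelPairing W Nat.prime_two B hB hkk
  exact ⟨primaryComponent_le_torsionBy hkk, B₂, hval, halt, hanti, hl, hr⟩

/-- **`Ш(E/ℚ)[2^∞]` carries a NON-DEGENERATE alternating `ℚ/ℤ`-valued pairing on U_T's frame, which IS Milne's level-`2^(M₀+3)` Cassels–Tate
pairing of the canonical invariant maps over `ℚ`** (a level pairing over every number field by gk2-p2's
`VisiblePairAtTwo.isLevelPairing_ctLevelPairing_canonical`; Weil pairing from `exists_weilPairing_holds`).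
[cite: MilneADT2006, Ch. I §6, Prop. 6.9, Thm. 6.13 (a)] [cite: Cassels1962ArithmeticIV] [cite: McCallumLMS1991, §5, proof of Thm. 5.4 (p. 288)] -/
theorem exists_nondegenerate_alternating_pairing_primaryComponent_sha_rat_two_onHabitat (hQ2 : KolyvaginRelationAtTwo)
    (W : WeierstrassCurve ℚ) [W.IsElliptic] [W.IsGloballyMinimal] [NeZero (W.conductorNorm ℤ)] (hcm : ¬ W.HasCM)
    (hT : Odd W.tamagawaProduct) (v : HeightOneSpectrum (𝓞 ℚ)) (h2v : ((2 : ℕ) : 𝓞 ℚ) ∉ v.asIdeal)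
    (hNv : ((W.conductorNorm ℤ : ℕ) : 𝓞 ℚ) ∈ v.asIdeal) (hmult : W.HasMultiplicativeReductionAt v) (hneg : W.Δ < 0)
    (K : Type) [Field K] [NumberField K] (hIQ : IsImaginaryQuadratic K) (hodd : Odd (NumberField.discr K))
    (h3 : NumberField.discr K ≠ -3) (hHe : SatisfiesHeegnerHypothesis (W.conductorNorm ℤ) K)
    (hsq1 : ¬ IsSquare ((NumberField.discr K : ℚ) * -|W.Δ|)) (hsq2 : ¬ IsSquare ((NumberField.discr K : ℚ) * (-(2 * |W.Δ|))))
    (hρ : ∀ n : ℕ, 0 < n → W.HasSurjectiveModNGaloisRep ((2 : ℤ) ^ n))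
    (Dt : ModularParametrizationData W (W.conductorNorm ℤ)) (β : ℤ) (ι : K →+* ℂ) (d₁ : KolyvaginHeegnerData Dt β ι 1) (M₀ : ℕ)
    (hndiv : ¬ ∃ Q : (W.baseChange (ringClassField K ι 1)).toAffine.Point, ((2 ^ (M₀ + 1) : ℕ) : ℤ) • Q = d₁.derivedPoint) :
    ∃ (B : (W.sha)[(2 ^ (M₀ + 3) : ℕ)] →+ (W.sha)[(2 ^ (M₀ + 3) : ℕ)] →+ AddCircle (1 : ℚ)) (_ : IsLevelPairing (2 ^ (M₀ + 3)) B)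
      (hle : AddCommGroup.primaryComponent W.sha 2 ≤ (W.sha)[(2 ^ (M₀ + 3) : ℕ)])
      (B₂ : AddCommGroup.primaryComponent W.sha 2 →+ AddCommGroup.primaryComponent W.sha 2 →+ AddCircle (1 : ℚ)),
      (∀ a b, B₂ a b = B ⟨a, hle a.2⟩ ⟨b, hle b.2⟩) ∧
      (∀ a, B₂ a a = 0) ∧ (∀ a b, B₂ b a = -(B₂ a b)) ∧
      (∀ a, (∀ b, B₂ a b = 0) → a = 0) ∧ (∀ b, (∀ a, B₂ a b = 0) → b = 0) := by
  haveI : Fact (Nat.Prime 2) := ⟨Nat.prime_two⟩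
  haveI : NeZero (2 ^ (M₀ + 3)) := ⟨pow_ne_zero _ two_ne_zero⟩
  haveI : NeZero (2 ^ (M₀ + 3) * 2 ^ (M₀ + 3)) := ⟨mul_ne_zero (NeZero.ne _) (NeZero.ne _)⟩
  have hk : 0 < M₀ + 3 := by omega
  have hpk : 2 ≤ 2 ^ (M₀ + 3) := le_trans (le_refl 2) (Nat.le_self_pow hk.ne' 2)
  have h2 : 2 ≤ 2 ^ (M₀ + 3) * 2 ^ (M₀ + 3) := le_trans hpk (Nat.le_mul_of_pos_right _ (NeZero.pos _))
  have hne : ((2 ^ (M₀ + 3) * 2 ^ (M₀ + 3) : ℕ) : ℚ) ≠ 0 := Nat.cast_ne_zero.2 (NeZero.ne _)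
  obtain ⟨e, hμ, hadd₁, hadd₂, halt, hnd, hgal⟩ := exists_weilPairing_holds W (2 ^ (M₀ + 3) * 2 ^ (M₀ + 3)) h2 hne
  have hB := VisiblePairAtTwo.isLevelPairing_ctLevelPairing_canonical W 2 (M₀ + 3) hk e hμ hadd₁ hadd₂ hgal halt hnd
  obtain ⟨hle, B₂, hval, halt₂, hanti, hl, hr⟩ := exists_primaryComponent_pairing_rat_of_isLevelPairing_onHabitat hQ2 W hcm hT v h2v hNv
    hmult hneg K hIQ hodd h3 hHe hsq1 hsq2 hρ Dt β ι d₁ M₀ hndiv le_rfl _ hB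
  exact ⟨_, hB, hle, B₂, hval, halt₂, hanti, hl, hr⟩

/-! ## §3 PAIRCOUNT as a bound on isotropic subgroups of `Ш(E/ℚ)[2^∞]` -/

/-- **PAIRCOUNT's conclusion from a bound on isotropic subgroups** (LINE 19's «`Zm` = a Lagrangian of `Ш(E/ℚ)[2^∞]`» door): on U_T's frame,
for ANY alternating non-degenerate `ℚ/ℤ`-valued pairing `B₂` on `Ш(E/ℚ)[2^∞]` (§2), if every `B₂`-isotropic subgroup has order `≤ 2^M₀` then
`#Ш(E/ℚ)[2^∞] ∣ 2^(2M₀)`. [cite: McCallumLMS1991, §5, Thm. 5.4 and its proof (p. 288)] [cite: Wall1963QuadraticFormsFiniteGroups, Lemma 7] -/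
theorem natCard_primaryComponent_sha_rat_two_dvd_of_forall_isotropic_card_le_onHabitat (hQ2 : KolyvaginRelationAtTwo)
    (W : WeierstrassCurve ℚ) [W.IsElliptic] [W.IsGloballyMinimal] [NeZero (W.conductorNorm ℤ)] (hcm : ¬ W.HasCM)
    (hT : Odd W.tamagawaProduct) (v : HeightOneSpectrum (𝓞 ℚ)) (h2v : ((2 : ℕ) : 𝓞 ℚ) ∉ v.asIdeal)
    (hNv : ((W.conductorNorm ℤ : ℕ) : 𝓞 ℚ) ∈ v.asIdeal) (hmult : W.HasMultiplicativeReductionAt v) (hneg : W.Δ < 0)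
    (K : Type) [Field K] [NumberField K] (hIQ : IsImaginaryQuadratic K) (hodd : Odd (NumberField.discr K))
    (h3 : NumberField.discr K ≠ -3) (hHe : SatisfiesHeegnerHypothesis (W.conductorNorm ℤ) K)
    (hsq1 : ¬ IsSquare ((NumberField.discr K : ℚ) * -|W.Δ|)) (hsq2 : ¬ IsSquare ((NumberField.discr K : ℚ) * (-(2 * |W.Δ|))))
    (hρ : ∀ n : ℕ, 0 < n → W.HasSurjectiveModNGaloisRep ((2 : ℤ) ^ n))
    (Dt : ModularParametrizationData W (W.conductorNorm ℤ)) (β : ℤ) (ι : K →+* ℂ) (d₁ : KolyvaginHeegnerData Dt β ι 1) (M₀ : ℕ)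
    (hndiv : ¬ ∃ Q : (W.baseChange (ringClassField K ι 1)).toAffine.Point, ((2 ^ (M₀ + 1) : ℕ) : ℤ) • Q = d₁.derivedPoint)
    (B₂ : AddCommGroup.primaryComponent W.sha 2 →+ AddCommGroup.primaryComponent W.sha 2 →+ AddCircle (1 : ℚ))
    (halt : ∀ x, B₂ x x = 0) (hnd : ∀ x, (∀ y, B₂ x y = 0) → x = 0)
    (hiso : ∀ D : AddSubgroup (AddCommGroup.primaryComponent W.sha 2), (∀ a ∈ D, ∀ b ∈ D, B₂ a b = 0) → Nat.card D ≤ 2 ^ M₀) :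
    Nat.card (AddCommGroup.primaryComponent W.sha 2) ∣ 2 ^ (2 * M₀) := by
  haveI := finite_primaryComponent_sha_rat_two_onHabitat hQ2 W hcm hT v h2v hNv hmult hneg K hIQ hodd h3 hHe hsq1 hsq2 hρ Dt β ι d₁ M₀ hndiv
  obtain ⟨t, ht⟩ := exists_natCard_primaryComponent_sha_rat_two_eq_pow_two_mul_onHabitat hQ2 W hcm hT v h2v hNv hmult hneg K hIQ hodd h3
    hHe hsq1 hsq2 hρ Dt β ι d₁ M₀ hndiv
  exact natCard_dvd_two_pow_two_mul_of_forall_isotropic_le B₂ ht halt hnd hiso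

end Summit.BirchSwinnertonDyer.BirchSwinnertonDyer.Theorems.GenusExact.PlusDescent

end
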